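/-
Copyright (c) 2026. All rights reserved.
Released under Apache 2.0 license as described in the file LICENSE.
Authors: abc-iut cell, seat abc-iut-L4-t15 (gen 6).
-/
import Literature.GroupTheory.CommutatorHypocentral
import Literature.GroupTheory.PByMetacyclicChiefFactors

/-!
# Solvable layers for the Hensel descent (p-group-by-metacyclic bounded commutator width)

For a slot tuple `g : Fin d → G`, a conjugating tuple `c` and entries `y` write
`Φ_{c•g}(y) = ∏_j ⁅y j, c j * g j * (c j)⁻¹⁆` (ordered product, Mathlib convention `⁅a,b⁆ = aba⁻¹b⁻¹`).
A pair of normal subgroups `A ⊇ B` is a *solvable layer* (for entries in `H`) if for every `c` and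
every `κ ∈ A` there are `y j ∈ H` with `κ⁻¹ * Φ_{c•g}(y) ∈ B` — the hypothesis of the Hensel descent of
`Literature/GroupTheory/CommutatorProductHensel.lean`.  This file supplies the three kinds of
solvable layers that occur inside a quasi-minimal normal subgroup `N` (with maximal proper normal `Z`)
of a finite group in the setting of `Literature/GroupTheory/PByMetacyclicChiefFactors.lean`:

* `layer_chief` — `(N, Z)`: through the chief factor, in the slot of a generator `u = g ju` all of whose
  conjugates act fixed-point-freely on `N/Z` (one non-trivial entry);
* `layer_pairing` — `(⁅N,P⁆·E, E)` for `⁅⁅N,P⁆, G⁆ ≤ E`: elements of `⁅N, P⁆` are congruent modulo `E`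
  to products `∏ ⁅n_j, g'_j⁆` over the slots with `g'_j ∈ P`, provided `P` is the normal closure of
  those slot elements (bilinearity of `N × P → ⁅N,P⁆/E` and conjugation-invariance);
* `layer_central_conj` — `(⁅A,G⁆, C)` for `⁅⁅A,G⁆,G⁆ ≤ C`: the central layer lemma of
  `CommutatorHypocentral` transported to CONJUGATED slots (`⁅z, cgc⁻¹⁆ ≡ ⁅c⁻¹zc, g⁆` modulo `C`).

Finite (in fact arbitrary) group theory over Mathlib; no definitions, no instances
(cell abc-iut, GAP-LEDGER G-L3d2g2-1).
-/

namespace Literature.GroupTheory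

open scoped commutatorElement

variable {G : Type*} [Group G]

/-! ### One non-trivial slot -/

/-- If all `b j` are central, `∏_j (a j * b j) = (∏_j a j) * (∏_j b j)`. [folklore] -/
private theorem prod_ofFn_mul_of_mem_center' {Q : Type*} [Group Q] {d : ℕ} (a b : Fin d → Q)
    (hb : ∀ j, b j ∈ Subgroup.center Q) :
    (List.ofFn fun j => a j * b j).prod = (List.ofFn a).prod * (List.ofFn b).prod := by
  induction d with
  | zero => simp
  | succ d ih =>
    simp only [List.ofFn_succ, List.prod_cons]
    rw [ih (fun i => a i.succ) (fun i => b i.succ) (fun i => hb i.succ)]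
    have hc : b 0 * (List.ofFn fun i : Fin d => a i.succ).prod =
        (List.ofFn fun i : Fin d => a i.succ).prod * b 0 :=
      (Subgroup.mem_center_iff.mp (hb 0) _).symm
    calc a 0 * b 0 * ((List.ofFn fun i : Fin d => a i.succ).prod * (List.ofFn fun i => b i.succ).prod)
        = a 0 * (b 0 * (List.ofFn fun i : Fin d => a i.succ).prod) *
            (List.ofFn fun i => b i.succ).prod := by simp only [mul_assoc]
      _ = a 0 * (List.ofFn fun i : Fin d => a i.succ).prod *
            (b 0 * (List.ofFn fun i => b i.succ).prod) := by rw [hc]; simp only [mul_assoc]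

/-- An ordered product of commutators whose entries are `1` except at one slot. [folklore] -/
private theorem prod_ofFn_commutator_update {d : ℕ} (g : Fin d → G) (j : Fin d) (a : G) :
    (List.ofFn fun i => ⁅Function.update (fun _ : Fin d => (1 : G)) j a i, g i⁆).prod = ⁅a, g j⁆ := by
  induction d with
  | zero => exact Fin.elim0 j
  | succ d ih =>
    rw [List.ofFn_succ, List.prod_cons]
    refine Fin.cases ?_ (fun j' => ?_) j
    · rw [Function.update_self]
      have : (List.ofFn fun i : Fin d =>
          ⁅Function.update (fun _ : Fin (d + 1) => (1 : G)) 0 a i.succ, g i.succ⁆) =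
          List.ofFn (fun _ : Fin d => (1 : G)) := by
        refine congrArg List.ofFn (funext fun i => ?_)
        rw [Function.update_of_ne (Fin.succ_ne_zero i)]; simp
      rw [this]; simp
    · rw [Function.update_of_ne (Fin.succ_ne_zero j').symm, commutatorElement_one_left, one_mul]
      have : (fun i : Fin d =>
          ⁅Function.update (fun _ : Fin (d + 1) => (1 : G)) j'.succ a i.succ, g i.succ⁆) =
          fun i => ⁅Function.update (fun _ : Fin d => (1 : G)) j' a i, g i.succ⁆ := by
        funext i
        by_cases h : i = j'
        · subst h; simp
        · rw [Function.update_of_ne h, Function.update_of_ne]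
          exact fun h' => h (Fin.succ_inj.mp h')
      rw [this, ih (fun i => g i.succ) j']

/-! ### The chief-factor layer -/

/-- **Chief-factor layer.** Let `Z ≤ N` be normal subgroups of a finite group with `⁅N, N⁆ ≤ Z`, and let
the slot `u = g ju` be such that EVERY conjugate of `u` acts fixed-point-freely on `N/Z`.  Then the
layer `(N, Z)` is solvable with a single non-trivial entry (in slot `ju`): for every conjugating tuple
`c` and `κ ∈ N` there is `y` (entries in `N`) with `κ⁻¹ * Φ_{c•g}(y) ∈ Z`.
[cite: NikolovSegal2007, §4] -/
theorem layer_chief [Finite G] {d : ℕ} (g : Fin d → G) (N Z : Subgroup G) [hN : N.Normal]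
    [hZ : Z.Normal] (hNN : ⁅N, N⁆ ≤ Z) (ju : Fin d)
    (hu : ∀ w : G, ∀ n ∈ N, ⁅n, w * g ju * w⁻¹⁆ ∈ Z → n ∈ Z)
    (c : Fin d → G) (κ : G) (hκ : κ ∈ N) :
    ∃ y : Fin d → G, (∀ j, y j ∈ N) ∧
      κ⁻¹ * (List.ofFn fun j => ⁅y j, c j * g j * (c j)⁻¹⁆).prod ∈ Z := by
  obtain ⟨a, ha, hκa⟩ :=
    exists_commutator_inv_mul_mem_of_fpf N Z hNN (c ju * g ju * (c ju)⁻¹) (hu (c ju)) κ hκ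
  refine ⟨Function.update (fun _ => (1 : G)) ju a, fun j => ?_, ?_⟩
  · by_cases h : j = ju
    · subst h; simpa using ha
    · rw [Function.update_of_ne h]; exact N.one_mem
  · rw [prod_ofFn_commutator_update]; exact hκa

/-! ### The pairing layer `⁅N, P⁆ / E` -/

/-- **Pairing layer.** Let `N, P, E ⊴ G` with `⁅⁅N, P⁆, G⁆ ≤ E`, so that `(n, y) ↦ ⁅n, y⁆ E` is a
bimultiplicative, conjugation-invariant pairing `N × P → ⁅N,P⁆/E` into a central section.  If `P` is the
normal closure of the slot elements `g' j` lying in `P`, then every `z ∈ ⁅N, P⁆` is congruent modulo `E`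
to an ordered product `∏_j ⁅y j, g' j⁆` with `y j ∈ N`, and `y j = 1` at the slots with `g' j ∉ P`.
[cite: NikolovSegal2007, §4] -/
theorem layer_pairing {d : ℕ} (g' : Fin d → G) (N P E : Subgroup G) [hN : N.Normal] [hP : P.Normal]
    [hE : E.Normal] (hNPE : ⁅⁅N, P⁆, (⊤ : Subgroup G)⁆ ≤ E)
    (hPgen : P ≤ Subgroup.normalClosure {x | x ∈ Set.range g' ∧ x ∈ P})
    {z : G} (hz : z ∈ ⁅N, P⁆) :
    ∃ y : Fin d → G, (∀ j, y j ∈ N) ∧ (∀ j, g' j ∉ P → y j = 1) ∧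
      z⁻¹ * (List.ofFn fun j => ⁅y j, g' j⁆).prod ∈ E := by
  classical
  set B : Subgroup G := ⁅N, P⁆ with hB
  let mk := QuotientGroup.mk' E
  have goal_iff : ∀ (z : G) (w : Fin d → G),
      z⁻¹ * (List.ofFn fun j => ⁅w j, g' j⁆).prod ∈ E ↔
        mk z = (List.ofFn fun j => mk ⁅w j, g' j⁆).prod := by
    intro z w
    rw [← QuotientGroup.eq, QuotientGroup.mk'_apply]
    change _ ↔ _ = (List.ofFn (mk ∘ fun j => ⁅w j, g' j⁆)).prod
    rw [← List.map_ofFn, ← map_list_prod]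
    rfl
  -- classes of `B` are central in `G ⧸ E`
  have hcen : ∀ {b : G}, b ∈ B → mk b ∈ Subgroup.center (G ⧸ E) := by
    intro b hb
    rw [Subgroup.mem_center_iff]
    intro q
    obtain ⟨x, rfl⟩ := QuotientGroup.mk'_surjective E q
    rw [← map_mul, ← map_mul, QuotientGroup.mk'_apply, QuotientGroup.mk'_apply, eq_comm,
      QuotientGroup.eq]
    have : (b * x)⁻¹ * (x * b) = (b * x)⁻¹ * ⁅b, x⁆⁻¹ * (b * x) := by
      simp only [commutatorElement_def]; group
    rw [this]
    exact hE.conj_mem' _ (E.inv_mem (hNPE (Subgroup.commutator_mem_commutator hb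
      (Subgroup.mem_top x)))) _
  -- the factor classes `mk ⁅y j, g' j⁆` for admissible entries are central (trivial at non-`P` slots)
  have hfac_cen : ∀ (w : Fin d → G), (∀ j, w j ∈ N) → (∀ j, g' j ∉ P → w j = 1) →
      ∀ j, mk ⁅w j, g' j⁆ ∈ Subgroup.center (G ⧸ E) := by
    intro w hw hw1 j
    by_cases hj : g' j ∈ P
    · exact hcen (Subgroup.commutator_mem_commutator (hw j) hj)
    · rw [hw1 j hj]; simp
  -- merging entries slotwise: `mk ⁅w,g⁆ * mk ⁅w',g⁆ = mk ⁅w w', g⁆` at `P`-slots, trivially elsewhere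
  have hmerge : ∀ (w w' : Fin d → G), (∀ j, w j ∈ N) → (∀ j, g' j ∉ P → w j = 1) →
      (∀ j, w' j ∈ N) → (∀ j, g' j ∉ P → w' j = 1) →
      (List.ofFn fun j => mk ⁅w j, g' j⁆).prod * (List.ofFn fun j => mk ⁅w' j, g' j⁆).prod =
        (List.ofFn fun j => mk ⁅w j * w' j, g' j⁆).prod := by
    intro w w' hw hw1 hw' hw'1
    rw [← prod_ofFn_mul_of_mem_center' _ _ (hfac_cen w' hw' hw'1)]
    refine congrArg (fun f : Fin d → G ⧸ E => (List.ofFn f).prod) (funext fun j => ?_)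
    by_cases hj : g' j ∈ P
    · -- `⁅w w', g⁆ = ⁅w, ⁅w',g⁆⁆ ⁅w',g⁆ ⁅w,g⁆ ≡ ⁅w,g⁆ ⁅w',g⁆`
      rw [← map_mul, eq_comm, QuotientGroup.mk'_apply, QuotientGroup.mk'_apply, QuotientGroup.eq,
        commutatorElement_mul_left_eq_conj_mul]
      have h1 : w j * ⁅w' j, g' j⁆ * (w j)⁻¹ = ⁅w j, ⁅w' j, g' j⁆⁆ * ⁅w' j, g' j⁆ := by
        simp only [commutatorElement_def]; group
      rw [h1]
      have hb' : ⁅w' j, g' j⁆ ∈ B := Subgroup.commutator_mem_commutator (hw' j) hj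
      have hb : ⁅w j, g' j⁆ ∈ B := Subgroup.commutator_mem_commutator (hw j) hj
      have hc1 : ⁅w j, ⁅w' j, g' j⁆⁆ ∈ E := by
        have : ⁅w j, ⁅w' j, g' j⁆⁆ ∈ ⁅(⊤ : Subgroup G), B⁆ :=
          Subgroup.commutator_mem_commutator (Subgroup.mem_top _) hb'
        rw [Subgroup.commutator_comm] at this
        exact hNPE this
      have hc2 : ⁅⁅w j, g' j⁆⁻¹, ⁅w' j, g' j⁆⁻¹⁆ ∈ E :=
        hNPE (Subgroup.commutator_mem_commutator (B.inv_mem hb) (Subgroup.mem_top _))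
      have heq : (⁅w j, ⁅w' j, g' j⁆⁆ * ⁅w' j, g' j⁆ * ⁅w j, g' j⁆)⁻¹ * (⁅w j, g' j⁆ * ⁅w' j, g' j⁆) =
          ((⁅w' j, g' j⁆ * ⁅w j, g' j⁆)⁻¹ * ⁅w j, ⁅w' j, g' j⁆⁆⁻¹ * (⁅w' j, g' j⁆ * ⁅w j, g' j⁆)) *
            ⁅⁅w j, g' j⁆⁻¹, ⁅w' j, g' j⁆⁻¹⁆ := by
        simp only [commutatorElement_def]; group
      rw [heq]
      exact E.mul_mem (hE.conj_mem' _ (E.inv_mem hc1) _) hc2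
    · rw [hw1 j hj, hw'1 j hj]; simp
  -- the predicate and its closure properties
  let Q : G → Prop := fun z => ∃ w : Fin d → G, (∀ j, w j ∈ N) ∧ (∀ j, g' j ∉ P → w j = 1) ∧
    mk z = (List.ofFn fun j => mk ⁅w j, g' j⁆).prod
  have Q_one : Q 1 := ⟨fun _ => 1, fun _ => N.one_mem, fun _ _ => rfl, by simp⟩
  have Q_mul : ∀ z z', Q z → Q z' → Q (z * z') := by
    rintro z z' ⟨w, hw, hw1, hz⟩ ⟨w', hw', hw'1, hz'⟩
    refine ⟨fun j => w j * w' j, fun j => N.mul_mem (hw j) (hw' j),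
      fun j hj => by simp [hw1 j hj, hw'1 j hj], ?_⟩
    rw [map_mul, hz, hz', hmerge w w' hw hw1 hw' hw'1]
  have Q_inv : ∀ z, Q z → Q z⁻¹ := by
    rintro z ⟨w, hw, hw1, hz⟩
    refine ⟨fun j => (w j)⁻¹, fun j => N.inv_mem (hw j), fun j hj => by simp [hw1 j hj], ?_⟩
    rw [map_inv, hz]
    apply inv_eq_of_mul_eq_one_right
    rw [hmerge w (fun j => (w j)⁻¹) hw hw1 (fun j => N.inv_mem (hw j))
      (fun j hj => by rw [hw1 j hj, inv_one])]
    simp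
  -- conjugation invariance of the pairing: `mk ⁅n, x y x⁻¹⁆ = mk ⁅x⁻¹ n x, y⁆` for `y ∈ P`
  have hconj : ∀ (n x y : G), n ∈ N → y ∈ P → mk ⁅n, x * y * x⁻¹⁆ = mk ⁅x⁻¹ * n * x, y⁆ := by
    intro n x y hn hy
    have h1 : ⁅n, x * y * x⁻¹⁆ = x * ⁅x⁻¹ * n * x, y⁆ * x⁻¹ := by
      simp only [commutatorElement_def]; group
    rw [h1, map_mul, map_mul]
    have hb : ⁅x⁻¹ * n * x, y⁆ ∈ B := Subgroup.commutator_mem_commutator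
      (by simpa using hN.conj_mem _ hn x⁻¹) hy
    rw [Subgroup.mem_center_iff.mp (hcen hb) (mk x), map_inv, mul_inv_cancel_right]
  -- the set of `y ∈ P` with `Q ⁅n, y⁆` for all `n ∈ N` contains the normal closure of the `P`-slots
  let S : Subgroup G :=
    { carrier := {y | y ∈ P ∧ ∀ n ∈ N, Q ⁅n, y⁆}
      mul_mem' := fun {y y'} hy hy' => ⟨P.mul_mem hy.1 hy'.1, fun n hn => by
        -- `⁅n, y y'⁆ = ⁅n, y⁆ * (y ⁅n, y'⁆ y⁻¹)` and the conjugate has the class of `⁅n, y'⁆`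
        obtain ⟨w, hw, hw1, h1⟩ := hy.2 n hn
        obtain ⟨w', hw', hw'1, h2⟩ := hy'.2 n hn
        refine ⟨fun j => w j * w' j, fun j => N.mul_mem (hw j) (hw' j),
          fun j hj => by simp [hw1 j hj, hw'1 j hj], ?_⟩
        have hxy : ⁅n, y * y'⁆ = ⁅n, y⁆ * (y * ⁅n, y'⁆ * y⁻¹) := by
          rw [commutatorElement_mul_right_eq_mul_conj]; group
        have hc' : mk (y * ⁅n, y'⁆ * y⁻¹) = mk ⁅n, y'⁆ := by
          have hcn := hcen (Subgroup.commutator_mem_commutator hn hy'.1)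
          rw [map_mul, map_mul, map_inv, Subgroup.mem_center_iff.mp hcn (mk y), mul_inv_cancel_right]
        rw [hxy, map_mul, hc', h1, h2, hmerge w w' hw hw1 hw' hw'1]⟩
      one_mem' := ⟨P.one_mem, fun n _ => by simpa using Q_one⟩
      inv_mem' := fun {y} hy => ⟨P.inv_mem hy.1, fun n hn => by
        obtain ⟨w, hw, hw1, h1⟩ := hy.2 n hn
        refine ⟨fun j => (w j)⁻¹, fun j => N.inv_mem (hw j),
          fun j hj => by simp [hw1 j hj], ?_⟩
        have hxy : ⁅n, y⁻¹⁆ = y⁻¹ * ⁅n, y⁆⁻¹ * y⁻¹⁻¹ := by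
          rw [commutatorElement_inv_right, ← commutatorElement_inv]; group
        have hc' : mk (y⁻¹ * ⁅n, y⁆⁻¹ * y⁻¹⁻¹) = (mk ⁅n, y⁆)⁻¹ := by
          have hcn := hcen (B.inv_mem (Subgroup.commutator_mem_commutator hn hy.1))
          rw [map_mul, map_mul, map_inv mk y⁻¹, Subgroup.mem_center_iff.mp hcn (mk y⁻¹),
            mul_inv_cancel_right, map_inv]
        rw [hxy, hc', h1]
        apply inv_eq_of_mul_eq_one_right
        rw [hmerge w (fun j => (w j)⁻¹) hw hw1 (fun j => N.inv_mem (hw j))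
          (fun j hj => by rw [hw1 j hj, inv_one])]
        simp⟩ }
  have hSn : S.Normal := by
    refine ⟨fun y hy x => ⟨hP.conj_mem _ hy.1 x, fun n hn => ?_⟩⟩
    obtain ⟨w, hw, hw1, h1⟩ := hy.2 (x⁻¹ * n * x) (by simpa using hN.conj_mem _ hn x⁻¹)
    exact ⟨w, hw, hw1, by rw [hconj n x y hn hy.1, h1]⟩
  have hgenS : ∀ j, g' j ∈ P → g' j ∈ S := by
    intro j hj
    refine ⟨hj, fun n hn => ⟨Function.update (fun _ => (1 : G)) j n, fun i => ?_, fun i hi => ?_, ?_⟩⟩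
    · by_cases h : i = j
      · subst h; simpa using hn
      · rw [Function.update_of_ne h]; exact N.one_mem
    · have h : i ≠ j := fun h => hi (h ▸ hj)
      rw [Function.update_of_ne h]
    · have h := prod_ofFn_commutator_update g' j n
      have hl : (List.ofFn fun i => mk ⁅Function.update (fun _ => (1 : G)) j n i, g' i⁆) =
          (List.ofFn fun i => ⁅Function.update (fun _ => (1 : G)) j n i, g' i⁆).map mk := by
        rw [List.map_ofFn]; rfl
      rw [hl, ← map_list_prod, h]
  have hPS : P ≤ S := by
    refine hPgen.trans ?_
    haveI := hSn
    apply Subgroup.normalClosure_le_normal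
    rintro x ⟨⟨j, rfl⟩, hx⟩
    exact hgenS j hx
  -- closure induction over `z ∈ ⁅N, P⁆`
  have key : ∀ x ∈ Subgroup.closure {x | ∃ n ∈ N, ∃ y ∈ P, ⁅n, y⁆ = x}, Q x := by
    intro x hx
    induction hx using Subgroup.closure_induction with
    | mem x hx =>
      obtain ⟨n, hn, y, hy, rfl⟩ := hx
      exact (hPS hy).2 n hn
    | one => exact Q_one
    | mul x y _ _ hx hy => exact Q_mul x y hx hy
    | inv x _ hx => exact Q_inv x hx
  have hzB : z ∈ Subgroup.closure {x | ∃ n ∈ N, ∃ y ∈ P, ⁅n, y⁆ = x} := by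
    rw [← Subgroup.commutator_def]; exact hz
  obtain ⟨w, hw, hw1, hzw⟩ := key z hzB
  exact ⟨w, hw, hw1, (goal_iff z w).mpr hzw⟩

/-! ### Central layers with conjugated slots -/

/-- **Central layer, conjugated slots.** Let `A, C ⊴ G` with `⁅⁅A, G⁆, G⁆ ≤ C` and let `g` generate `G`.
Then for every conjugating tuple `c`, every `z ∈ ⁅A, G⁆` is congruent modulo `C` to
`∏_j ⁅y j, c j * g j * (c j)⁻¹⁆` with `y j ∈ A` (take `y j = c j * w j * (c j)⁻¹` for a representation
`z ≡ ∏ ⁅w j, g j⁆`: conjugating a factor of the central layer does not change its class).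
[cite: NikolovSegal2007, Lemma 2.4] -/
theorem layer_central_conj {d : ℕ} (g : Fin d → G) (hgen : Subgroup.closure (Set.range g) = ⊤)
    (A C : Subgroup G) [hA : A.Normal] [hC : C.Normal]
    (hBC : ⁅⁅A, (⊤ : Subgroup G)⁆, (⊤ : Subgroup G)⁆ ≤ C) (c : Fin d → G)
    {z : G} (hz : z ∈ ⁅A, (⊤ : Subgroup G)⁆) :
    ∃ y : Fin d → G, (∀ j, y j ∈ A) ∧
      z⁻¹ * (List.ofFn fun j => ⁅y j, c j * g j * (c j)⁻¹⁆).prod ∈ C := by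
  obtain ⟨w, hw, hzw⟩ := exists_prod_commutator_of_mem_commutator g hgen A C hBC hz
  refine ⟨fun j => c j * w j * (c j)⁻¹, fun j => hA.conj_mem _ (hw j) _, ?_⟩
  let mk := QuotientGroup.mk' C
  -- each conjugated factor has the class of the unconjugated one
  have hfac : ∀ j, mk ⁅c j * w j * (c j)⁻¹, c j * g j * (c j)⁻¹⁆ = mk ⁅w j, g j⁆ := by
    intro j
    rw [← conjugate_commutatorElement, QuotientGroup.mk'_apply, QuotientGroup.mk'_apply,
      QuotientGroup.eq]
    have hb : ⁅w j, g j⁆ ∈ ⁅A, (⊤ : Subgroup G)⁆ :=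
      Subgroup.commutator_mem_commutator (hw j) (Subgroup.mem_top _)
    have : (c j * ⁅w j, g j⁆ * (c j)⁻¹)⁻¹ * ⁅w j, g j⁆ = c j * ⁅⁅w j, g j⁆⁻¹, (c j)⁻¹⁆ * (c j)⁻¹ := by
      simp only [commutatorElement_def]; group
    rw [this]
    exact hC.conj_mem _ (hBC (Subgroup.commutator_mem_commutator
      ((⁅A, (⊤ : Subgroup G)⁆).inv_mem hb) (Subgroup.mem_top _))) _
  have hprod : mk (List.ofFn fun j => ⁅c j * w j * (c j)⁻¹, c j * g j * (c j)⁻¹⁆).prod =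
      mk (List.ofFn fun j => ⁅w j, g j⁆).prod := by
    rw [map_list_prod, map_list_prod, List.map_ofFn, List.map_ofFn]
    exact congrArg (fun f : Fin d → G ⧸ C => (List.ofFn f).prod) (funext hfac)
  rw [← QuotientGroup.eq] at hzw ⊢
  rw [QuotientGroup.mk'_apply, QuotientGroup.mk'_apply] at hprod
  rw [hprod]; exact hzw

/-! ### Conjugating the slots preserves the normal-generation hypothesis -/

/-- If `P ⊴ G` is contained in the normal closure of the slot elements `g j ∈ P`, the same holds for
any conjugated slot tuple `c j * g j * (c j)⁻¹` (bookkeeping for the conjugated slots in the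
Nikolov–Segal lifting step). [cite: NikolovSegal2007, §4] -/
theorem le_normalClosure_slots_conj {d : ℕ} (g : Fin d → G) (P : Subgroup G) [hP : P.Normal]
    (hPgen : P ≤ Subgroup.normalClosure {x | x ∈ Set.range g ∧ x ∈ P}) (c : Fin d → G) :
    P ≤ Subgroup.normalClosure
      {x | x ∈ Set.range (fun j => c j * g j * (c j)⁻¹) ∧ x ∈ P} := by
  refine hPgen.trans (Subgroup.normalClosure_le_normal ?_)
  rintro x ⟨⟨j, rfl⟩, hx⟩
  have hmem : c j * g j * (c j)⁻¹ ∈ Subgroup.normalClosure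
      {x | x ∈ Set.range (fun j => c j * g j * (c j)⁻¹) ∧ x ∈ P} :=
    Subgroup.subset_normalClosure ⟨⟨j, rfl⟩, hP.conj_mem _ hx _⟩
  have := (Subgroup.normalClosure_normal (s := {x | x ∈ Set.range (fun j => c j * g j * (c j)⁻¹) ∧
    x ∈ P})).conj_mem _ hmem (c j)⁻¹
  simpa [mul_assoc] using this

end Literature.GroupTheory
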